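import Summits.QuantumFields.BalabanUV.Beta.GAN24.CombContactCellLetters
import Summits.QuantumFields.BalabanUV.Beta.GAN24.ContactCellBounds

/-!
# `BalabanUV.Beta.GAN24.CombContactCellBounds` — binder row G-an2-4 ∕ (CONV-C), TRANSFER-III, the (III′) S-slot (b) of the END `CombChargeRowsClosed`, the (III′) WILSON
# CONTACT END `hCT′` (M.104 `CombSRowsOfContactLetters`'s first hypothesis), part 3: **THE THREE ONE-GAUGE CELLS OF THE (III′) CONTACT TERM BOUNDED IN CLOSED FORM** —
# the (III′) twin of MY g58 (E) `ContactCellBounds`, for road-P2's M.59 cells `contact_combLegChain_ff_eq_cells` (conjugated legs `T′` in the dressed slots, gauge functions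
# `λ′ = Ψ + PsiFace − bmGauge`): the SAME reductions (`ContactCellReduction`, leaf-02's `ContactOneGaugeCellTable.abs_cellIdx_le'`) and the SAME staircase pairings (the OWNER's
# `StaircasePairing.abs_pairing_le_sum ∕ sum_weights_le_of_geometric`, leaf-03's `StaircasePairingReadings.abs_pairingTip_le_of_geometric`) BY NAME, fed with the (III′) letters of
# `CombContactCellLetters` and the ONE-SCALE-LONGER staircase of `CombContactGaugeStaircase` (length `k+1`, geometric letter `α₁ = α₀ + F·(1 + 8·Lc·(e^{κ₀}+1))·C·(Lc^{5(k+1)})⁻¹`).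

NOT IN PRINT; OUR BOOKKEEPING (G-an2-4 formalisation swarm, leaf prover `b2b-balaban-gan24-formalise-leaf-01`, gen 89; MY (E) `ContactCellBounds` transformed BY NAME: `T ↦ T′`, `λ ↦ λ′`,
staircase length `k ↦ k+1`, `α₀ ↦ α₁`, `Lc^k ↦ Lc^{k+1}`; (E)'s `hE` GONE — fibre summability is the OWNER's `LegL1`; [folklore]; 0 `def`, 0 cited facts, 0 `def … : Prop`, 0 sorry).
HONEST FRAMING (cell contract, verbatim): «discharging `BetaPertH` makes Bałaban's UV stability UNCONDITIONAL — a real constructive-QFT result; it is NOT the continuum limit and NOT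
the Clay problem.»  HONEST DEPENDENCY (verbatim): «continuum YM on T⁴ ⇐ BetaPertH ∧ nine spine estimates (0/9 proved); BetaPertH ⇐ (D1) ∧ (D4) ∧ CAP+tail; G-an2-4 gates asym, D1 and NE2/3/4.»

WHAT (`d = 3`, `2 ≤ Lc`, in-block roots `r` (of `Ψ̂_S`), `rr` (dressing), `ρ = toSite rr`, `N = Lc^(k+1)`, `T′ = legChain (j ↦ legComp ψ♭ (respStepBmSeq ρ Lc j)) 0 k`, `B = respStep (Lc^0) (Lc^(0+k+1))`,
`λ′ μ z = Psi ρ Lc 0 k (delta1 μ z) + PsiFace r ρ Lc 0 k (delta1 μ z) − bmGaugeAt ρ (B μ z) Lc`; letters (N1) `C`, I1 `Φ₀`, the tent bound, face letter `F ≥ faceWtSum r Lc`; notation of MY (E)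
`ContactCellBounds` with `α₀ ↦ α₁ = α₀ + F·(1+8Lc(e^{κ₀}+1))·C·(Lc^{5(k+1)})⁻¹`, `Eψ ↦ Eψ′ = 2α₁·Lc^{k+1}`, `P ↦ P′ = 8e^{5κ₀}α₁²Lc^{k+1}(2τ + Φ₀′Lc^{k+1})`):
§1 **`abs_cellL_bound`**, §2 **`abs_cellR_bound`**, §3 **`abs_cellW_bound`** — the (E) closed forms with these substitutions.  NO estimate; NOTHING of (hS, hSall) by itself; NEVER «G-an2-4 closed» as (CONV-C); NOT D1, NOT BetaPertH, NOT continuum, NOT Clay.  2026-08-28; no existing file touched. -/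

noncomputable section

open Finset
open scoped BigOperators
open Literature.MathematicalPhysics.QuantumFieldTheory
open Literature.MathematicalPhysics.QuantumFieldTheory.LatticeForm (quo)
open Literature.MathematicalPhysics.QuantumFieldTheory.Balaban1983to89
open Literature.MathematicalPhysics.QuantumFieldTheory.Balaban1983to89.Beta
open B4ContourShift (supNorm supNorm_nonneg)
open ExpKernelCalculus (Zl Zl_nonneg)
open AffineAveraging (Form0 Form1 Site box toSite curv curvAdj dz)
open AffineReproduction (contourSumAdj)
open AveragingContours (blk)
open KernelSpecInstance (wΦ)
open B6BondElimination (unitVec)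
open KKTFluctuationKernel (delta1)
open BalabanCompositeJets (respStep)
open Summit.QuantumFields.BalabanUV.Beta.AxialProjectorBlockMean (bmGaugeAt)
open Summit.QuantumFields.BalabanUV.Beta.SymCorrectorKernel (psiKS)
open Summit.QuantumFields.BalabanUV.Beta.SymCorrectorForms (zetaS)
open Summit.QuantumFields.BalabanUV.Beta.SymCorrectorFace (faceWtSum faceWtSum_nonneg)
open Summit.QuantumFields.BalabanUV.Beta.GAN24.Push4 (legComp)
open Summit.QuantumFields.BalabanUV.Beta.GAN24.Push4Iter (LegFam legChain)
open Summit.QuantumFields.BalabanUV.Beta.GAN24.RespStepBmDecompLegs (legAct)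
open Summit.QuantumFields.BalabanUV.Beta.GAN24.RespStepBmDecompExact (respStepBmSeq)
open Summit.QuantumFields.BalabanUV.Beta.GAN24.RespStepBmDecompPsi (Psi)
open Summit.QuantumFields.BalabanUV.Beta.GAN24.EnvelopeBlockSum (env_le_one summable_env)
open Summit.QuantumFields.BalabanUV.Beta.GAN24.ContactOneGaugeCellAlgebra (affine_unitVec_eq dz_apply')
open Summit.QuantumFields.BalabanUV.Beta.GAN24.ContactOneGaugeCellBound (tsum_env3_le abs_le_of_env summable_of_env)
open Summit.QuantumFields.BalabanUV.Beta.GAN24.ContactOneGaugeCellTable (abs_cellIdx_le')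
open Summit.QuantumFields.BalabanUV.Beta.GAN24.ContactCellReduction (abs_cellL_le_pieces abs_cellR_le_pieces abs_le_of_env₁ summable_of_env₁ env3_nonneg)
open Summit.QuantumFields.BalabanUV.Beta.GAN24.ContactPartnerLetters (respStep_pow_zero)
open Summit.QuantumFields.BalabanUV.Beta.GAN24.StaircasePairing (abs_pairing_le_sum sum_weights_le_of_geometric sum_pow_le)
open Summit.QuantumFields.BalabanUV.Beta.GAN24.StaircasePairingReadings (abs_pairingTip_le_of_geometric)
open Summit.QuantumFields.BalabanUV.Beta.GAN24.ContactCellLetters (curvAdj_curv_respStep_zero_eq_contourSumAdj)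
open Summit.QuantumFields.BalabanUV.Beta.GAN24.CombLegChainGauge (PsiFace)
open Summit.QuantumFields.BalabanUV.Beta.GAN24.CombContactGaugeStaircase (combGauge_eq_staircase abs_combGaugePiece_le abs_combGauge_le)
open Summit.QuantumFields.BalabanUV.Beta.GAN24.CombContactCellLetters (combLegChain_apply_eq summable_combLegChain curvAdj_curv_combLegChain_zero_eq_contourSumAdj)

namespace Summit.QuantumFields.BalabanUV.Beta.GAN24.CombContactCellBounds

variable {Lc : ℕ} [NeZero Lc]

/-! ## §1 The LEFT cell -/

section Cells

variable {κ₀ C Φ₀ F : ℝ} {r rr : Fin (3 + 1) → ℕ}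

/-- NOT IN PRINT; OUR BOOKKEEPING.  **THE LEFT CELL OF THE (III′) CONTACT TERM, BOUNDED** (`d = 3`, `2 ≤ Lc`, in-block roots `r, rr`; parametric in the letters at one rate:
(N1) `C`, I1 `Φ₀`, the translated tent bound, and the face letter `F ≥ faceWtSum r Lc`): for every `k κ′ u′ x′ z′ α β`,
`|LEFT cell| ≤ ½·4·Eψ′e^{κ₀}·(C_Bτ + C_Bτ)·ENV(x′;u′,z′) + ½·4·P′·ENV(z′;x′,u′) + ½·4·P′·ENV(u′;x′,z′)`, `P′ = 8e^{5κ₀}α₁²Lc^{k+1}(2τ + Φ₀′Lc^{k+1})` (notation of the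
module docstring; MY (E) `ContactCellBounds.abs_cellL_bound` with `T ↦ T′`, `λ ↦ λ′`, staircase length `k+1`). -/
theorem abs_cellL_bound (hLc : 2 ≤ Lc) (hr : r ∈ box (3 + 1) Lc) (hrr : rr ∈ box (3 + 1) Lc) (hF : faceWtSum r Lc ≤ F) (hκ : 0 < κ₀) (hC : 0 ≤ C) (hΦ : 0 ≤ Φ₀)
    (hN1 : ∀ (m k : ℕ) (μ : Fin (3 + 1)) (z : Site (3 + 1)) (l'' : Fin (3 + 1)) (w' : Site (3 + 1)),
      |respStep (d := 3) (Lc ^ m) (Lc ^ (m + k + 1)) μ z l'' w'| ≤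
        C * ((Lc : ℝ) ^ (5 * (k + 1)))⁻¹ * Real.exp (-(κ₀ * supNorm (quo (Lc ^ (k + 1)) w' - z))))
    (hΦenv : ∀ (k : ℕ) (μ : Fin (3 + 1)) (z : Site (3 + 1)) (κ : Fin (3 + 1)) (y : Site (3 + 1)),
      |wΦ (N := Lc ^ (k + 1)) κ μ (y - z)| ≤ Φ₀ * ((Lc : ℝ) ^ (8 * (k + 1)))⁻¹ * Real.exp (-(κ₀ * supNorm (y - z))))
    (ht : ∀ (k : ℕ) (μ : Fin (3 + 1)) (z : Site (3 + 1)) (κ : Fin (3 + 1)) (u : Site (3 + 1)),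
      |contourSumAdj (Lc ^ (k + 1)) (fun κ y => wΦ (N := Lc ^ (k + 1)) κ μ (y - z)) κ u|
        ≤ (Lc ^ (k + 1) : ℕ) * (Φ₀ * ((Lc : ℝ) ^ (8 * (k + 1)))⁻¹) * Real.exp κ₀ * Real.exp (-(κ₀ * supNorm (quo (Lc ^ (k + 1)) u - z))))
    (k : ℕ) (κ' : Fin (3 + 1)) (u' x' z' : Site (3 + 1)) (α β : Fin (3 + 1)) :
    |∑' z, ∑ b, legChain (fun j => legComp (fun α x κ u => psiKS r Lc u x (Sum.inl κ) (Sum.inl α)) (respStepBmSeq (d := 3) (toSite rr) Lc j)) 0 k β z' b z *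
        ∑' u, ∑ κ, legChain (fun j => legComp (fun α x κ u => psiKS r Lc u x (Sum.inl κ) (Sum.inl α)) (respStepBmSeq (d := 3) (toSite rr) Lc j)) 0 k κ' u' κ u *
          ((1 / 2 : ℝ) *
            ((Psi (toSite rr) Lc 0 k (delta1 α x') + PsiFace r (toSite rr) Lc 0 k (delta1 α x') - bmGaugeAt (toSite rr) (respStep (d := 3) (Lc ^ 0) (Lc ^ (0 + k + 1)) α x') Lc) (u + unitVec κ)
              - ((Psi (toSite rr) Lc 0 k (delta1 α x') + PsiFace r (toSite rr) Lc 0 k (delta1 α x') - bmGaugeAt (toSite rr) (respStep (d := 3) (Lc ^ 0) (Lc ^ (0 + k + 1)) α x') Lc) z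
                + (Psi (toSite rr) Lc 0 k (delta1 α x') + PsiFace r (toSite rr) Lc 0 k (delta1 α x') - bmGaugeAt (toSite rr) (respStep (d := 3) (Lc ^ 0) (Lc ^ (0 + k + 1)) α x') Lc)
                  (z + unitVec b)) / 2) * curvAdj (curv (delta1 κ u)) b z)|
      ≤ (1 / 2 : ℝ) * ((((3 : ℕ) : ℝ) + 1) * ((2 * (8 * (Lc : ℝ) * C * ((Lc : ℝ) ^ (5 * (k + 1)))⁻¹ + F * ((1 + 8 * (Lc : ℝ) * (Real.exp κ₀ + 1)) * C * ((Lc : ℝ) ^ (5 * (k + 1)))⁻¹)) * (Lc : ℝ) ^ (k + 1)) * Real.exp κ₀) *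
            ((C * ((Lc : ℝ) ^ (5 * (k + 1)))⁻¹) * ((Lc ^ (k + 1) : ℕ) * (Φ₀ * ((Lc : ℝ) ^ (8 * (k + 1)))⁻¹) * Real.exp κ₀)
              + (C * ((Lc : ℝ) ^ (5 * (k + 1)))⁻¹) * ((Lc ^ (k + 1) : ℕ) * (Φ₀ * ((Lc : ℝ) ^ (8 * (k + 1)))⁻¹) * Real.exp κ₀))) *
          ((((Lc ^ (k + 1) : ℕ) : ℝ)) ^ (3 + 1) * Zl (3 + 1) (κ₀ / (4 * (((3 : ℕ) : ℝ) + 1))) *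
            Real.exp (-(κ₀ / 12) * (supNorm (u' - x') + supNorm (z' - x'))))
        + (1 / 2 : ℝ) * ((((3 : ℕ) : ℝ) + 1) *
          ((8 * Real.exp (5 * κ₀) * (8 * (Lc : ℝ) * C * ((Lc : ℝ) ^ (5 * (k + 1)))⁻¹ + F * ((1 + 8 * (Lc : ℝ) * (Real.exp κ₀ + 1)) * C * ((Lc : ℝ) ^ (5 * (k + 1)))⁻¹)) * (8 * (Lc : ℝ) * C * ((Lc : ℝ) ^ (5 * (k + 1)))⁻¹ + F * ((1 + 8 * (Lc : ℝ) * (Real.exp κ₀ + 1)) * C * ((Lc : ℝ) ^ (5 * (k + 1)))⁻¹)) *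
              (Lc : ℝ) ^ (k + 1) * (2 * ((Lc ^ (k + 1) : ℕ) * (Φ₀ * ((Lc : ℝ) ^ (8 * (k + 1)))⁻¹) * Real.exp κ₀)
                + (Φ₀ * ((Lc : ℝ) ^ (8 * (k + 1)))⁻¹) * (Lc : ℝ) ^ (k + 1))) *
            ((((Lc ^ (k + 1) : ℕ) : ℝ)) ^ (3 + 1) * Zl (3 + 1) (κ₀ / (4 * (((3 : ℕ) : ℝ) + 1))) *
              Real.exp (-(κ₀ / 12) * (supNorm (x' - z') + supNorm (u' - z'))))))
        + (1 / 2 : ℝ) * ((((3 : ℕ) : ℝ) + 1) *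
          ((8 * Real.exp (5 * κ₀) * (8 * (Lc : ℝ) * C * ((Lc : ℝ) ^ (5 * (k + 1)))⁻¹ + F * ((1 + 8 * (Lc : ℝ) * (Real.exp κ₀ + 1)) * C * ((Lc : ℝ) ^ (5 * (k + 1)))⁻¹)) * (8 * (Lc : ℝ) * C * ((Lc : ℝ) ^ (5 * (k + 1)))⁻¹ + F * ((1 + 8 * (Lc : ℝ) * (Real.exp κ₀ + 1)) * C * ((Lc : ℝ) ^ (5 * (k + 1)))⁻¹)) *
              (Lc : ℝ) ^ (k + 1) * (2 * ((Lc ^ (k + 1) : ℕ) * (Φ₀ * ((Lc : ℝ) ^ (8 * (k + 1)))⁻¹) * Real.exp κ₀)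
                + (Φ₀ * ((Lc : ℝ) ^ (8 * (k + 1)))⁻¹) * (Lc : ℝ) ^ (k + 1))) *
            ((((Lc ^ (k + 1) : ℕ) : ℝ)) ^ (3 + 1) * Zl (3 + 1) (κ₀ / (4 * (((3 : ℕ) : ℝ) + 1))) *
              Real.exp (-(κ₀ / 12) * (supNorm (x' - u') + supNorm (z' - u')))))) := by
  haveI : NeZero (Lc ^ (k + 1)) := ⟨pow_ne_zero _ (NeZero.ne Lc)⟩
  have hL1 : 1 ≤ Lc := by omega
  have hF0 : 0 ≤ F := (faceWtSum_nonneg r Lc).trans hF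
  have hN1' : 1 ≤ Lc ^ (k + 1) := Nat.one_le_pow _ _ (by omega)
  have hL0 : (0 : ℝ) ≤ (Lc : ℝ) := Nat.cast_nonneg _
  -- names
  set N : ℕ := Lc ^ (k + 1) with hNdef
  set T : LegFam 3 := legChain (fun j => legComp (fun α x κ u => psiKS r Lc u x (Sum.inl κ) (Sum.inl α)) (respStepBmSeq (d := 3) (toSite rr) Lc j)) 0 k with hT
  set B : LegFam 3 := respStep (d := 3) (Lc ^ 0) (Lc ^ (0 + k + 1)) with hB
  set lam : Fin (3 + 1) → Site (3 + 1) → Form0 (3 + 1) ℝ :=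
    fun μ z => Psi (toSite rr) Lc 0 k (delta1 μ z) + PsiFace r (toSite rr) Lc 0 k (delta1 μ z) - bmGaugeAt (toSite rr) (B μ z) Lc with hlam
  set φ : Fin (3 + 1) → Site (3 + 1) → Form1 (3 + 1) ℝ := fun μ z κ y => wΦ (N := N) κ μ (y - z) with hφ
  set α0 : ℝ := (8 * (Lc : ℝ) * C * ((Lc : ℝ) ^ (5 * (k + 1)))⁻¹ + F * ((1 + 8 * (Lc : ℝ) * (Real.exp κ₀ + 1)) * C * ((Lc : ℝ) ^ (5 * (k + 1)))⁻¹)) with hα0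
  set Eψ : ℝ := 2 * α0 * (Lc : ℝ) ^ (k + 1) with hEψ
  set CB : ℝ := C * ((Lc : ℝ) ^ (5 * (k + 1)))⁻¹ with hCB
  set Φ₀' : ℝ := Φ₀ * ((Lc : ℝ) ^ (8 * (k + 1)))⁻¹ with hΦ₀'
  set τ : ℝ := (N : ℕ) * Φ₀' * Real.exp κ₀ with hτ
  have hα00 : 0 ≤ α0 := by positivity
  have hEψ0 : 0 ≤ Eψ := by positivity
  have hCB0 : 0 ≤ CB := by positivity
  have hΦ₀'0 : 0 ≤ Φ₀' := by positivity
  have hτ0 : 0 ≤ τ := by positivity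
  -- the letters of the three objects
  have hψenv : ∀ (μ : Fin (3 + 1)) (z : Site (3 + 1)) (u : Site (3 + 1)),
      |lam μ z u| ≤ Eψ * Real.exp (-(κ₀ * supNorm (quo N u - z))) := fun μ z u => abs_combGauge_le hκ.le hC hN1 hr hrr hF hLc 0 k μ z u
  have hTeq : ∀ (μ : Fin (3 + 1)) (z : Site (3 + 1)) (κ : Fin (3 + 1)) (u : Site (3 + 1)),
      T μ z κ u = B μ z κ u + (lam μ z (u + unitVec κ) - lam μ z u) := fun μ z κ u => combLegChain_apply_eq hr hrr 0 k μ z κ u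
  have hBenv : ∀ (μ : Fin (3 + 1)) (z : Site (3 + 1)) (κ : Fin (3 + 1)) (u : Site (3 + 1)),
      |B μ z κ u| ≤ CB * Real.exp (-(κ₀ * supNorm (quo N u - z))) := fun μ z κ u => hN1 0 k μ z κ u
  have hgb : ∀ (μ : Fin (3 + 1)) (z : Site (3 + 1)) (x : Site (3 + 1)), |lam μ z x| ≤ Eψ :=
    fun μ z x => abs_le_of_env (L := N) hκ.le hEψ0 (hψenv μ z) x
  have hTs : ∀ (μ : Fin (3 + 1)) (z : Site (3 + 1)) (b : Fin (3 + 1)), Summable (T μ z b) :=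
    fun μ z b => summable_combLegChain hr hrr 0 k μ z b
  have hM : ∀ (μ : Fin (3 + 1)) (z : Site (3 + 1)), curvAdj (curv (T μ z)) = contourSumAdj N (φ μ z) :=
    fun μ z => curvAdj_curv_combLegChain_zero_eq_contourSumAdj hr hrr k μ z
  have htenv : ∀ (μ : Fin (3 + 1)) (z : Site (3 + 1)) (κ : Fin (3 + 1)) (u : Site (3 + 1)),
      |contourSumAdj N (φ μ z) κ u| ≤ τ * Real.exp (-(κ₀ * supNorm (quo N u - z))) := by
    intro μ z κ u; have h := ht k μ z κ u; rw [hτ]; exact h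
  -- the reduction to pieces
  have hred := abs_cellL_le_pieces (N := N) (d := 3) hN1' hκ hEψ0 hCB0 hCB0 hτ0 hτ0 (ψ := lam α x') (c₀ := x')
    (T₁ := T κ' u') (T₃ := T β z') (B₁ := B κ' u') (B₃ := B β z') (lam₁ := lam κ' u') (lam₃ := lam β z') (c₁ := u') (c₃ := z')
    (φ₁ := φ κ' u') (φ₃ := φ β z') (hψenv α x') (hTeq κ' u') (hTeq β z') (hBenv κ' u') (hBenv β z') (hgb κ' u') (hgb β z') (hTs β z')
    (hM κ' u') (hM β z') (htenv κ' u') (htenv β z')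
  refine hred.trans ?_
  -- the staircase data of the two gauge functions and the tent data, for the pairing lemmas
  have hdvd : ∀ s, s ≤ k + 1 → Lc ^ s ∣ N := fun s hs => pow_dvd_pow Lc (by omega)
  have hφenv : ∀ (μ : Fin (3 + 1)) (z : Site (3 + 1)) (κ : Fin (3 + 1)) (y : Site (3 + 1)),
      |φ μ z κ y| ≤ Φ₀' * Real.exp (-(κ₀ * supNorm (y - z))) := fun μ z κ y => hΦenv k μ z κ y
  have hpiece := fun (μ : Fin (3 + 1)) (z : Site (3 + 1)) (s : ℕ) (hs : s ≤ k + 1) (u : Site (3 + 1)) =>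
    abs_combGaugePiece_le hκ.le hC hN1 hr hrr hF 0 k μ z hs u
  have hstair := fun (μ : Fin (3 + 1)) (z : Site (3 + 1)) (u : Site (3 + 1)) => combGauge_eq_staircase (Lc := Lc) r (toSite rr) 0 k μ z u
  have haL : ∀ s : ℕ, α0 * (Lc : ℝ) ^ s ≤ α0 * (Lc : ℝ) ^ s := fun s => le_rfl
  have ha0 : ∀ s : ℕ, 0 ≤ α0 * (Lc : ℝ) ^ s := fun s => by positivity
  -- tip pairing (partner 1 = table leg about u′) against the tent of partner 3 (about z′): per direction
  have htip : ∀ κ : Fin (3 + 1), |∑' u, contourSumAdj N (φ β z') κ u * lam α x' (u + AffineAveraging.unitVec κ) *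
      (lam κ' u' (u + AffineAveraging.unitVec κ) - lam κ' u' u)|
        ≤ (8 * Real.exp (5 * κ₀) * α0 * α0 * (Lc : ℝ) ^ (k + 1) * (2 * τ + Φ₀' * (Lc : ℝ) ^ (k + 1))) *
          ∑' u : Site (3 + 1), Real.exp (-(κ₀ * supNorm (quo N u - z'))) * Real.exp (-(κ₀ * supNorm (quo N u - x'))) *
            Real.exp (-(κ₀ * supNorm (quo N u - u'))) := by
    intro κ
    exact abs_pairingTip_le_of_geometric (N := N) (Lc := Lc) (k := k + 1) (y₀ := z') (c₁ := x') (c₂ := u') (φ := φ β z')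
      (G₁ := fun s y => (if s ≤ k then (if s = 0 then -bmGaugeAt (toSite rr) (respStep (d := 3) (Lc ^ 0) (Lc ^ (0 + k + 1)) α x') Lc y
        else -(((Lc : ℝ) ^ ((3 + 1) * s))⁻¹ * bmGaugeAt (toSite rr) (legAct (respStep (d := 3) (Lc ^ (0 + s)) (Lc ^ (0 + k + 1))) (delta1 α x')) Lc y)) else 0)
        + (if s = 0 then 0 else ((Lc : ℝ) ^ ((3 + 1) * (s - 1)))⁻¹ * ((((box (3 + 1) Lc).card : ℝ))⁻¹ *
          zetaS (toSite r) Lc (legAct (legChain (respStepBmSeq (d := 3) (toSite rr) Lc) (0 + (s - 1)) (k - (s - 1))) (delta1 α x')) y)))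
      (G₂ := fun s y => (if s ≤ k then (if s = 0 then -bmGaugeAt (toSite rr) (respStep (d := 3) (Lc ^ 0) (Lc ^ (0 + k + 1)) κ' u') Lc y
        else -(((Lc : ℝ) ^ ((3 + 1) * s))⁻¹ * bmGaugeAt (toSite rr) (legAct (respStep (d := 3) (Lc ^ (0 + s)) (Lc ^ (0 + k + 1))) (delta1 κ' u')) Lc y)) else 0)
        + (if s = 0 then 0 else ((Lc : ℝ) ^ ((3 + 1) * (s - 1)))⁻¹ * ((((box (3 + 1) Lc).card : ℝ))⁻¹ *
          zetaS (toSite r) Lc (legAct (legChain (respStepBmSeq (d := 3) (toSite rr) Lc) (0 + (s - 1)) (k - (s - 1))) (delta1 κ' u')) y)))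
      (a := fun s => α0 * (Lc : ℝ) ^ s) (b := fun s => α0 * (Lc : ℝ) ^ s)
      hκ.le hτ0 hΦ₀'0 hLc hα00 hα00 ha0 ha0 haL haL hdvd (hφenv β z') (htenv β z')
      (fun s hs u => hpiece α x' s hs u) (fun s hs u => hpiece κ' u' s hs u) (tsum_env3_le hN1' hκ z' x' u').1
      (hstair α x') (hstair κ' u') κ
  -- midpoint pairing (partner 3 = right leg about z′) against the tent of partner 1 (about u′)
  have hmid : ∀ b : Fin (3 + 1), |∑' z, contourSumAdj N (φ κ' u') b z * ((lam α x' z + lam α x' (z + AffineAveraging.unitVec b)) / 2) *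
      (lam β z' (z + AffineAveraging.unitVec b) - lam β z' z)|
        ≤ (8 * Real.exp (5 * κ₀) * α0 * α0 * (Lc : ℝ) ^ (k + 1) * (2 * τ + Φ₀' * (Lc : ℝ) ^ (k + 1))) *
          ∑' u : Site (3 + 1), Real.exp (-(κ₀ * supNorm (quo N u - u'))) * Real.exp (-(κ₀ * supNorm (quo N u - x'))) *
            Real.exp (-(κ₀ * supNorm (quo N u - z'))) := by
    intro b
    refine (abs_pairing_le_sum (N := N) (Lc := Lc) (k := k + 1) (y₀ := u') (c₁ := x') (c₂ := z') (φ := φ κ' u')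
      (G₁ := fun s y => (if s ≤ k then (if s = 0 then -bmGaugeAt (toSite rr) (respStep (d := 3) (Lc ^ 0) (Lc ^ (0 + k + 1)) α x') Lc y
        else -(((Lc : ℝ) ^ ((3 + 1) * s))⁻¹ * bmGaugeAt (toSite rr) (legAct (respStep (d := 3) (Lc ^ (0 + s)) (Lc ^ (0 + k + 1))) (delta1 α x')) Lc y)) else 0)
        + (if s = 0 then 0 else ((Lc : ℝ) ^ ((3 + 1) * (s - 1)))⁻¹ * ((((box (3 + 1) Lc).card : ℝ))⁻¹ *
          zetaS (toSite r) Lc (legAct (legChain (respStepBmSeq (d := 3) (toSite rr) Lc) (0 + (s - 1)) (k - (s - 1))) (delta1 α x')) y)))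
      (G₂ := fun s y => (if s ≤ k then (if s = 0 then -bmGaugeAt (toSite rr) (respStep (d := 3) (Lc ^ 0) (Lc ^ (0 + k + 1)) β z') Lc y
        else -(((Lc : ℝ) ^ ((3 + 1) * s))⁻¹ * bmGaugeAt (toSite rr) (legAct (respStep (d := 3) (Lc ^ (0 + s)) (Lc ^ (0 + k + 1))) (delta1 β z')) Lc y)) else 0)
        + (if s = 0 then 0 else ((Lc : ℝ) ^ ((3 + 1) * (s - 1)))⁻¹ * ((((box (3 + 1) Lc).card : ℝ))⁻¹ *
          zetaS (toSite r) Lc (legAct (legChain (respStepBmSeq (d := 3) (toSite rr) Lc) (0 + (s - 1)) (k - (s - 1))) (delta1 β z')) y)))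
      (a := fun s => α0 * (Lc : ℝ) ^ s) (b := fun s => α0 * (Lc : ℝ) ^ s)
      hκ.le hτ0 hΦ₀'0 hL1 ha0 ha0 hdvd (hφenv κ' u') (htenv κ' u')
      (fun s hs u => hpiece α x' s hs u) (fun s hs u => hpiece β z' s hs u) (tsum_env3_le hN1' hκ u' x' z').1
      (hstair α x') (hstair β z') b).trans ?_
    exact mul_le_mul_of_nonneg_right (sum_weights_le_of_geometric hLc hκ.le hτ0 hΦ₀'0 hα00 hα00 ha0 ha0 haL haL)
      (tsum_nonneg fun u => by positivity)
  -- the two envelope sums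
  have hS3 := (tsum_env3_le (d := 3) hN1' hκ z' x' u').2
  have hS1 := (tsum_env3_le (d := 3) hN1' hκ u' x' z').2
  have hP0 : 0 ≤ 8 * Real.exp (5 * κ₀) * α0 * α0 * (Lc : ℝ) ^ (k + 1) * (2 * τ + Φ₀' * (Lc : ℝ) ^ (k + 1)) := by positivity
  have htipS : ∑ κ : Fin (3 + 1), |∑' u, contourSumAdj N (φ β z') κ u * lam α x' (u + AffineAveraging.unitVec κ) *
      (lam κ' u' (u + AffineAveraging.unitVec κ) - lam κ' u' u)|
        ≤ (((3 : ℕ) : ℝ) + 1) * ((8 * Real.exp (5 * κ₀) * α0 * α0 * (Lc : ℝ) ^ (k + 1) * (2 * τ + Φ₀' * (Lc : ℝ) ^ (k + 1))) *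
          ((((N : ℕ) : ℝ)) ^ (3 + 1) * Zl (3 + 1) (κ₀ / (4 * (((3 : ℕ) : ℝ) + 1))) *
            Real.exp (-(κ₀ / 12) * (supNorm (x' - z') + supNorm (u' - z'))))) := by
    calc ∑ κ : Fin (3 + 1), |∑' u, contourSumAdj N (φ β z') κ u * lam α x' (u + AffineAveraging.unitVec κ) *
          (lam κ' u' (u + AffineAveraging.unitVec κ) - lam κ' u' u)|
        ≤ ∑ _κ : Fin (3 + 1), (8 * Real.exp (5 * κ₀) * α0 * α0 * (Lc : ℝ) ^ (k + 1) * (2 * τ + Φ₀' * (Lc : ℝ) ^ (k + 1))) *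
          ((((N : ℕ) : ℝ)) ^ (3 + 1) * Zl (3 + 1) (κ₀ / (4 * (((3 : ℕ) : ℝ) + 1))) *
            Real.exp (-(κ₀ / 12) * (supNorm (x' - z') + supNorm (u' - z')))) :=
          Finset.sum_le_sum fun κ _ => (htip κ).trans (mul_le_mul_of_nonneg_left hS3 hP0)
      _ = _ := by rw [Finset.sum_const, Finset.card_univ, Fintype.card_fin, nsmul_eq_mul]; push_cast; ring
  have hmidS : ∑ b : Fin (3 + 1), |∑' z, contourSumAdj N (φ κ' u') b z * ((lam α x' z + lam α x' (z + AffineAveraging.unitVec b)) / 2) *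
      (lam β z' (z + AffineAveraging.unitVec b) - lam β z' z)|
        ≤ (((3 : ℕ) : ℝ) + 1) * ((8 * Real.exp (5 * κ₀) * α0 * α0 * (Lc : ℝ) ^ (k + 1) * (2 * τ + Φ₀' * (Lc : ℝ) ^ (k + 1))) *
          ((((N : ℕ) : ℝ)) ^ (3 + 1) * Zl (3 + 1) (κ₀ / (4 * (((3 : ℕ) : ℝ) + 1))) *
            Real.exp (-(κ₀ / 12) * (supNorm (x' - u') + supNorm (z' - u'))))) := by
    calc ∑ b : Fin (3 + 1), |∑' z, contourSumAdj N (φ κ' u') b z * ((lam α x' z + lam α x' (z + AffineAveraging.unitVec b)) / 2) *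
          (lam β z' (z + AffineAveraging.unitVec b) - lam β z' z)|
        ≤ ∑ _b : Fin (3 + 1), (8 * Real.exp (5 * κ₀) * α0 * α0 * (Lc : ℝ) ^ (k + 1) * (2 * τ + Φ₀' * (Lc : ℝ) ^ (k + 1))) *
          ((((N : ℕ) : ℝ)) ^ (3 + 1) * Zl (3 + 1) (κ₀ / (4 * (((3 : ℕ) : ℝ) + 1))) *
            Real.exp (-(κ₀ / 12) * (supNorm (x' - u') + supNorm (z' - u')))) :=
          Finset.sum_le_sum fun b _ => (hmid b).trans (mul_le_mul_of_nonneg_left hS1 hP0)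
      _ = _ := by rw [Finset.sum_const, Finset.card_univ, Fintype.card_fin, nsmul_eq_mul]; push_cast; ring
  have h12 : (0 : ℝ) ≤ 1 / 2 := by norm_num
  have := add_le_add (add_le_add (le_refl ((1 / 2 : ℝ) * ((((3 : ℕ) : ℝ) + 1) * (Eψ * Real.exp κ₀) * (CB * τ + CB * τ)) *
          ((((N : ℕ) : ℝ)) ^ (3 + 1) * Zl (3 + 1) (κ₀ / (4 * (((3 : ℕ) : ℝ) + 1))) *
            Real.exp (-(κ₀ / 12) * (supNorm (u' - x') + supNorm (z' - x'))))))
    (mul_le_mul_of_nonneg_left htipS h12)) (mul_le_mul_of_nonneg_left hmidS h12)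
  exact this

/-! ## §2 The RIGHT cell -/

/-- NOT IN PRINT; OUR BOOKKEEPING.  **THE RIGHT CELL OF THE (III′) CONTACT TERM, BOUNDED** (the outer partner `B α x′` UNDRESSED; the inner partner `T′ κ′ u′` conjugated, in
the tip position; gauge weight `λ′ β z′`): `|RIGHT cell| ≤ ½·4·Eψ′e^{κ₀}(C_Bτ + C_Bτ)·ENV(z′;u′,x′) + ½·4·P′·ENV(x′;z′,u′)` (MY (E) `abs_cellR_bound`, transformed BY NAME). -/
theorem abs_cellR_bound (hLc : 2 ≤ Lc) (hr : r ∈ box (3 + 1) Lc) (hrr : rr ∈ box (3 + 1) Lc) (hF : faceWtSum r Lc ≤ F) (hκ : 0 < κ₀) (hC : 0 ≤ C) (hΦ : 0 ≤ Φ₀)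
    (hN1 : ∀ (m k : ℕ) (μ : Fin (3 + 1)) (z : Site (3 + 1)) (l'' : Fin (3 + 1)) (w' : Site (3 + 1)),
      |respStep (d := 3) (Lc ^ m) (Lc ^ (m + k + 1)) μ z l'' w'| ≤
        C * ((Lc : ℝ) ^ (5 * (k + 1)))⁻¹ * Real.exp (-(κ₀ * supNorm (quo (Lc ^ (k + 1)) w' - z))))
    (hΦenv : ∀ (k : ℕ) (μ : Fin (3 + 1)) (z : Site (3 + 1)) (κ : Fin (3 + 1)) (y : Site (3 + 1)),
      |wΦ (N := Lc ^ (k + 1)) κ μ (y - z)| ≤ Φ₀ * ((Lc : ℝ) ^ (8 * (k + 1)))⁻¹ * Real.exp (-(κ₀ * supNorm (y - z))))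
    (ht : ∀ (k : ℕ) (μ : Fin (3 + 1)) (z : Site (3 + 1)) (κ : Fin (3 + 1)) (u : Site (3 + 1)),
      |contourSumAdj (Lc ^ (k + 1)) (fun κ y => wΦ (N := Lc ^ (k + 1)) κ μ (y - z)) κ u|
        ≤ (Lc ^ (k + 1) : ℕ) * (Φ₀ * ((Lc : ℝ) ^ (8 * (k + 1)))⁻¹) * Real.exp κ₀ * Real.exp (-(κ₀ * supNorm (quo (Lc ^ (k + 1)) u - z))))
    (k : ℕ) (κ' : Fin (3 + 1)) (u' x' z' : Site (3 + 1)) (α β : Fin (3 + 1)) :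
    |∑' x, ∑ a, respStep (d := 3) (Lc ^ 0) (Lc ^ (0 + k + 1)) α x' a x *
        ∑' u, ∑ κ, legChain (fun j => legComp (fun α x κ u => psiKS r Lc u x (Sum.inl κ) (Sum.inl α)) (respStepBmSeq (d := 3) (toSite rr) Lc j)) 0 k κ' u' κ u *
          ((1 / 2 : ℝ) *
            ((Psi (toSite rr) Lc 0 k (delta1 β z') + PsiFace r (toSite rr) Lc 0 k (delta1 β z') - bmGaugeAt (toSite rr) (respStep (d := 3) (Lc ^ 0) (Lc ^ (0 + k + 1)) β z') Lc) (u + unitVec κ)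
              - ((Psi (toSite rr) Lc 0 k (delta1 β z') + PsiFace r (toSite rr) Lc 0 k (delta1 β z') - bmGaugeAt (toSite rr) (respStep (d := 3) (Lc ^ 0) (Lc ^ (0 + k + 1)) β z') Lc) x
                + (Psi (toSite rr) Lc 0 k (delta1 β z') + PsiFace r (toSite rr) Lc 0 k (delta1 β z') - bmGaugeAt (toSite rr) (respStep (d := 3) (Lc ^ 0) (Lc ^ (0 + k + 1)) β z') Lc)
                  (x + unitVec a)) / 2) * curvAdj (curv (delta1 κ u)) a x)|
      ≤ (1 / 2 : ℝ) * ((((3 : ℕ) : ℝ) + 1) * ((2 * (8 * (Lc : ℝ) * C * ((Lc : ℝ) ^ (5 * (k + 1)))⁻¹ + F * ((1 + 8 * (Lc : ℝ) * (Real.exp κ₀ + 1)) * C * ((Lc : ℝ) ^ (5 * (k + 1)))⁻¹)) * (Lc : ℝ) ^ (k + 1)) * Real.exp κ₀) *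
            ((C * ((Lc : ℝ) ^ (5 * (k + 1)))⁻¹) * ((Lc ^ (k + 1) : ℕ) * (Φ₀ * ((Lc : ℝ) ^ (8 * (k + 1)))⁻¹) * Real.exp κ₀)
              + (C * ((Lc : ℝ) ^ (5 * (k + 1)))⁻¹) * ((Lc ^ (k + 1) : ℕ) * (Φ₀ * ((Lc : ℝ) ^ (8 * (k + 1)))⁻¹) * Real.exp κ₀))) *
          ((((Lc ^ (k + 1) : ℕ) : ℝ)) ^ (3 + 1) * Zl (3 + 1) (κ₀ / (4 * (((3 : ℕ) : ℝ) + 1))) *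
            Real.exp (-(κ₀ / 12) * (supNorm (u' - z') + supNorm (x' - z'))))
        + (1 / 2 : ℝ) * ((((3 : ℕ) : ℝ) + 1) *
          ((8 * Real.exp (5 * κ₀) * (8 * (Lc : ℝ) * C * ((Lc : ℝ) ^ (5 * (k + 1)))⁻¹ + F * ((1 + 8 * (Lc : ℝ) * (Real.exp κ₀ + 1)) * C * ((Lc : ℝ) ^ (5 * (k + 1)))⁻¹)) * (8 * (Lc : ℝ) * C * ((Lc : ℝ) ^ (5 * (k + 1)))⁻¹ + F * ((1 + 8 * (Lc : ℝ) * (Real.exp κ₀ + 1)) * C * ((Lc : ℝ) ^ (5 * (k + 1)))⁻¹)) *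
              (Lc : ℝ) ^ (k + 1) * (2 * ((Lc ^ (k + 1) : ℕ) * (Φ₀ * ((Lc : ℝ) ^ (8 * (k + 1)))⁻¹) * Real.exp κ₀)
                + (Φ₀ * ((Lc : ℝ) ^ (8 * (k + 1)))⁻¹) * (Lc : ℝ) ^ (k + 1))) *
            ((((Lc ^ (k + 1) : ℕ) : ℝ)) ^ (3 + 1) * Zl (3 + 1) (κ₀ / (4 * (((3 : ℕ) : ℝ) + 1))) *
              Real.exp (-(κ₀ / 12) * (supNorm (z' - x') + supNorm (u' - x')))))) := by
  haveI : NeZero (Lc ^ (k + 1)) := ⟨pow_ne_zero _ (NeZero.ne Lc)⟩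
  have hL1 : 1 ≤ Lc := by omega
  have hF0 : 0 ≤ F := (faceWtSum_nonneg r Lc).trans hF
  have hN1' : 1 ≤ Lc ^ (k + 1) := Nat.one_le_pow _ _ (by omega)
  set N : ℕ := Lc ^ (k + 1) with hNdef
  set T : LegFam 3 := legChain (fun j => legComp (fun α x κ u => psiKS r Lc u x (Sum.inl κ) (Sum.inl α)) (respStepBmSeq (d := 3) (toSite rr) Lc j)) 0 k with hT
  set B : LegFam 3 := respStep (d := 3) (Lc ^ 0) (Lc ^ (0 + k + 1)) with hB
  set lam : Fin (3 + 1) → Site (3 + 1) → Form0 (3 + 1) ℝ :=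
    fun μ z => Psi (toSite rr) Lc 0 k (delta1 μ z) + PsiFace r (toSite rr) Lc 0 k (delta1 μ z) - bmGaugeAt (toSite rr) (B μ z) Lc with hlam
  set φ : Fin (3 + 1) → Site (3 + 1) → Form1 (3 + 1) ℝ := fun μ z κ y => wΦ (N := N) κ μ (y - z) with hφ
  set α0 : ℝ := (8 * (Lc : ℝ) * C * ((Lc : ℝ) ^ (5 * (k + 1)))⁻¹ + F * ((1 + 8 * (Lc : ℝ) * (Real.exp κ₀ + 1)) * C * ((Lc : ℝ) ^ (5 * (k + 1)))⁻¹)) with hα0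
  set Eψ : ℝ := 2 * α0 * (Lc : ℝ) ^ (k + 1) with hEψ
  set CB : ℝ := C * ((Lc : ℝ) ^ (5 * (k + 1)))⁻¹ with hCB
  set Φ₀' : ℝ := Φ₀ * ((Lc : ℝ) ^ (8 * (k + 1)))⁻¹ with hΦ₀'
  set τ : ℝ := (N : ℕ) * Φ₀' * Real.exp κ₀ with hτ
  have hα00 : 0 ≤ α0 := by positivity
  have hEψ0 : 0 ≤ Eψ := by positivity
  have hCB0 : 0 ≤ CB := by positivity
  have hΦ₀'0 : 0 ≤ Φ₀' := by positivity
  have hτ0 : 0 ≤ τ := by positivity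
  have hψenv : ∀ (μ : Fin (3 + 1)) (z : Site (3 + 1)) (u : Site (3 + 1)),
      |lam μ z u| ≤ Eψ * Real.exp (-(κ₀ * supNorm (quo N u - z))) := fun μ z u => abs_combGauge_le hκ.le hC hN1 hr hrr hF hLc 0 k μ z u
  have hTeq : ∀ (μ : Fin (3 + 1)) (z : Site (3 + 1)) (κ : Fin (3 + 1)) (u : Site (3 + 1)),
      T μ z κ u = B μ z κ u + (lam μ z (u + unitVec κ) - lam μ z u) := fun μ z κ u => combLegChain_apply_eq hr hrr 0 k μ z κ u
  have hBenv : ∀ (μ : Fin (3 + 1)) (z : Site (3 + 1)) (κ : Fin (3 + 1)) (u : Site (3 + 1)),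
      |B μ z κ u| ≤ CB * Real.exp (-(κ₀ * supNorm (quo N u - z))) := fun μ z κ u => hN1 0 k μ z κ u
  have hgb : ∀ (μ : Fin (3 + 1)) (z : Site (3 + 1)) (x : Site (3 + 1)), |lam μ z x| ≤ Eψ :=
    fun μ z x => abs_le_of_env (L := N) hκ.le hEψ0 (hψenv μ z) x
  have hM : ∀ (μ : Fin (3 + 1)) (z : Site (3 + 1)), curvAdj (curv (T μ z)) = contourSumAdj N (φ μ z) :=
    fun μ z => curvAdj_curv_combLegChain_zero_eq_contourSumAdj hr hrr k μ z
  have hMB : ∀ (μ : Fin (3 + 1)) (z : Site (3 + 1)), curvAdj (curv (B μ z)) = contourSumAdj N (φ μ z) :=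
    fun μ z => curvAdj_curv_respStep_zero_eq_contourSumAdj (Lc := Lc) k μ z
  have htenv : ∀ (μ : Fin (3 + 1)) (z : Site (3 + 1)) (κ : Fin (3 + 1)) (u : Site (3 + 1)),
      |contourSumAdj N (φ μ z) κ u| ≤ τ * Real.exp (-(κ₀ * supNorm (quo N u - z))) := by
    intro μ z κ u; have h := ht k μ z κ u; rw [hτ]; exact h
  have hred := abs_cellR_le_pieces (N := N) (d := 3) hN1' hκ hEψ0 hCB0 hCB0 hτ0 hτ0 (ψ := lam β z') (c₀ := z')
    (T₁ := T κ' u') (B₁ := B κ' u') (B₃ := B α x') (lam₁ := lam κ' u') (c₁ := u') (c₃ := x') (φ₁ := φ κ' u') (φ₃ := φ α x')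
    (hψenv β z') (hTeq κ' u') (hBenv κ' u') (hBenv α x') (hgb κ' u') (hM κ' u') (hMB α x') (htenv κ' u') (htenv α x')
  refine hred.trans ?_
  have hdvd : ∀ s, s ≤ k + 1 → Lc ^ s ∣ N := fun s hs => pow_dvd_pow Lc (by omega)
  have hφenv : ∀ (μ : Fin (3 + 1)) (z : Site (3 + 1)) (κ : Fin (3 + 1)) (y : Site (3 + 1)),
      |φ μ z κ y| ≤ Φ₀' * Real.exp (-(κ₀ * supNorm (y - z))) := fun μ z κ y => hΦenv k μ z κ y
  have hpiece := fun (μ : Fin (3 + 1)) (z : Site (3 + 1)) (s : ℕ) (hs : s ≤ k + 1) (u : Site (3 + 1)) =>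
    abs_combGaugePiece_le hκ.le hC hN1 hr hrr hF 0 k μ z hs u
  have hstair := fun (μ : Fin (3 + 1)) (z : Site (3 + 1)) (u : Site (3 + 1)) => combGauge_eq_staircase (Lc := Lc) r (toSite rr) 0 k μ z u
  have haL : ∀ s : ℕ, α0 * (Lc : ℝ) ^ s ≤ α0 * (Lc : ℝ) ^ s := fun s => le_rfl
  have ha0 : ∀ s : ℕ, 0 ≤ α0 * (Lc : ℝ) ^ s := fun s => by positivity
  have htip : ∀ κ : Fin (3 + 1), |∑' u, contourSumAdj N (φ α x') κ u * lam β z' (u + AffineAveraging.unitVec κ) *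
      (lam κ' u' (u + AffineAveraging.unitVec κ) - lam κ' u' u)|
        ≤ (8 * Real.exp (5 * κ₀) * α0 * α0 * (Lc : ℝ) ^ (k + 1) * (2 * τ + Φ₀' * (Lc : ℝ) ^ (k + 1))) *
          ∑' u : Site (3 + 1), Real.exp (-(κ₀ * supNorm (quo N u - x'))) * Real.exp (-(κ₀ * supNorm (quo N u - z'))) *
            Real.exp (-(κ₀ * supNorm (quo N u - u'))) := by
    intro κ
    exact abs_pairingTip_le_of_geometric (N := N) (Lc := Lc) (k := k + 1) (y₀ := x') (c₁ := z') (c₂ := u') (φ := φ α x')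
      (G₁ := fun s y => (if s ≤ k then (if s = 0 then -bmGaugeAt (toSite rr) (respStep (d := 3) (Lc ^ 0) (Lc ^ (0 + k + 1)) β z') Lc y
        else -(((Lc : ℝ) ^ ((3 + 1) * s))⁻¹ * bmGaugeAt (toSite rr) (legAct (respStep (d := 3) (Lc ^ (0 + s)) (Lc ^ (0 + k + 1))) (delta1 β z')) Lc y)) else 0)
        + (if s = 0 then 0 else ((Lc : ℝ) ^ ((3 + 1) * (s - 1)))⁻¹ * ((((box (3 + 1) Lc).card : ℝ))⁻¹ *
          zetaS (toSite r) Lc (legAct (legChain (respStepBmSeq (d := 3) (toSite rr) Lc) (0 + (s - 1)) (k - (s - 1))) (delta1 β z')) y)))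
      (G₂ := fun s y => (if s ≤ k then (if s = 0 then -bmGaugeAt (toSite rr) (respStep (d := 3) (Lc ^ 0) (Lc ^ (0 + k + 1)) κ' u') Lc y
        else -(((Lc : ℝ) ^ ((3 + 1) * s))⁻¹ * bmGaugeAt (toSite rr) (legAct (respStep (d := 3) (Lc ^ (0 + s)) (Lc ^ (0 + k + 1))) (delta1 κ' u')) Lc y)) else 0)
        + (if s = 0 then 0 else ((Lc : ℝ) ^ ((3 + 1) * (s - 1)))⁻¹ * ((((box (3 + 1) Lc).card : ℝ))⁻¹ *
          zetaS (toSite r) Lc (legAct (legChain (respStepBmSeq (d := 3) (toSite rr) Lc) (0 + (s - 1)) (k - (s - 1))) (delta1 κ' u')) y)))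
      (a := fun s => α0 * (Lc : ℝ) ^ s) (b := fun s => α0 * (Lc : ℝ) ^ s)
      hκ.le hτ0 hΦ₀'0 hLc hα00 hα00 ha0 ha0 haL haL hdvd (hφenv α x') (htenv α x')
      (fun s hs u => hpiece β z' s hs u) (fun s hs u => hpiece κ' u' s hs u) (tsum_env3_le hN1' hκ x' z' u').1
      (hstair β z') (hstair κ' u') κ
  have hS3 := (tsum_env3_le (d := 3) hN1' hκ x' z' u').2
  have hP0 : 0 ≤ 8 * Real.exp (5 * κ₀) * α0 * α0 * (Lc : ℝ) ^ (k + 1) * (2 * τ + Φ₀' * (Lc : ℝ) ^ (k + 1)) := by positivity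
  have htipS : ∑ κ : Fin (3 + 1), |∑' u, contourSumAdj N (φ α x') κ u * lam β z' (u + AffineAveraging.unitVec κ) *
      (lam κ' u' (u + AffineAveraging.unitVec κ) - lam κ' u' u)|
        ≤ (((3 : ℕ) : ℝ) + 1) * ((8 * Real.exp (5 * κ₀) * α0 * α0 * (Lc : ℝ) ^ (k + 1) * (2 * τ + Φ₀' * (Lc : ℝ) ^ (k + 1))) *
          ((((N : ℕ) : ℝ)) ^ (3 + 1) * Zl (3 + 1) (κ₀ / (4 * (((3 : ℕ) : ℝ) + 1))) *
            Real.exp (-(κ₀ / 12) * (supNorm (z' - x') + supNorm (u' - x'))))) := by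
    calc ∑ κ : Fin (3 + 1), |∑' u, contourSumAdj N (φ α x') κ u * lam β z' (u + AffineAveraging.unitVec κ) *
          (lam κ' u' (u + AffineAveraging.unitVec κ) - lam κ' u' u)|
        ≤ ∑ _κ : Fin (3 + 1), (8 * Real.exp (5 * κ₀) * α0 * α0 * (Lc : ℝ) ^ (k + 1) * (2 * τ + Φ₀' * (Lc : ℝ) ^ (k + 1))) *
          ((((N : ℕ) : ℝ)) ^ (3 + 1) * Zl (3 + 1) (κ₀ / (4 * (((3 : ℕ) : ℝ) + 1))) *
            Real.exp (-(κ₀ / 12) * (supNorm (z' - x') + supNorm (u' - x')))) :=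
          Finset.sum_le_sum fun κ _ => (htip κ).trans (mul_le_mul_of_nonneg_left hS3 hP0)
      _ = _ := by rw [Finset.sum_const, Finset.card_univ, Fintype.card_fin, nsmul_eq_mul]; push_cast; ring
  have h12 : (0 : ℝ) ≤ 1 / 2 := by norm_num
  exact add_le_add (le_refl _) (mul_le_mul_of_nonneg_left htipS h12)

/-! ## §3 The TABLE cell -/

/-- NOT IN PRINT; OUR BOOKKEEPING.  **THE TABLE CELL OF THE (III′) CONTACT TERM, BOUNDED** (both partners undressed; site weights `λ′ κ′ u′`; leaf-02's `abs_cellIdx_le'` as it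
stands, fed with the plain envelope `abs_combGauge_le`): `|TABLE cell| ≤ ½·4·Eψ′e^{κ₀}(C_Bτ + C_Bτ)·ENV(u′;x′,z′)`. -/
theorem abs_cellW_bound (hLc : 2 ≤ Lc) (hr : r ∈ box (3 + 1) Lc) (hrr : rr ∈ box (3 + 1) Lc) (hF : faceWtSum r Lc ≤ F) (hκ : 0 < κ₀) (hC : 0 ≤ C) (hΦ : 0 ≤ Φ₀)
    (hN1 : ∀ (m k : ℕ) (μ : Fin (3 + 1)) (z : Site (3 + 1)) (l'' : Fin (3 + 1)) (w' : Site (3 + 1)),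
      |respStep (d := 3) (Lc ^ m) (Lc ^ (m + k + 1)) μ z l'' w'| ≤
        C * ((Lc : ℝ) ^ (5 * (k + 1)))⁻¹ * Real.exp (-(κ₀ * supNorm (quo (Lc ^ (k + 1)) w' - z))))
    (ht : ∀ (k : ℕ) (μ : Fin (3 + 1)) (z : Site (3 + 1)) (κ : Fin (3 + 1)) (u : Site (3 + 1)),
      |contourSumAdj (Lc ^ (k + 1)) (fun κ y => wΦ (N := Lc ^ (k + 1)) κ μ (y - z)) κ u|
        ≤ (Lc ^ (k + 1) : ℕ) * (Φ₀ * ((Lc : ℝ) ^ (8 * (k + 1)))⁻¹) * Real.exp κ₀ * Real.exp (-(κ₀ * supNorm (quo (Lc ^ (k + 1)) u - z))))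
    (k : ℕ) (κ' : Fin (3 + 1)) (u' x' z' : Site (3 + 1)) (α β : Fin (3 + 1)) :
    |∑' z, ∑ b, respStep (d := 3) (Lc ^ 0) (Lc ^ (0 + k + 1)) β z' b z *
        ∑' x, ∑ a, respStep (d := 3) (Lc ^ 0) (Lc ^ (0 + k + 1)) α x' a x *
          ((1 / 2 : ℝ) *
            ((Psi (toSite rr) Lc 0 k (delta1 κ' u') + PsiFace r (toSite rr) Lc 0 k (delta1 κ' u') - bmGaugeAt (toSite rr) (respStep (d := 3) (Lc ^ 0) (Lc ^ (0 + k + 1)) κ' u') Lc) z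
              - (Psi (toSite rr) Lc 0 k (delta1 κ' u') + PsiFace r (toSite rr) Lc 0 k (delta1 κ' u') - bmGaugeAt (toSite rr) (respStep (d := 3) (Lc ^ 0) (Lc ^ (0 + k + 1)) κ' u') Lc) x) *
            curvAdj (curv (delta1 b z)) a x)|
      ≤ (1 / 2 : ℝ) * ((((3 : ℕ) : ℝ) + 1) * ((2 * (8 * (Lc : ℝ) * C * ((Lc : ℝ) ^ (5 * (k + 1)))⁻¹ + F * ((1 + 8 * (Lc : ℝ) * (Real.exp κ₀ + 1)) * C * ((Lc : ℝ) ^ (5 * (k + 1)))⁻¹)) * (Lc : ℝ) ^ (k + 1)) * Real.exp κ₀) *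
            ((C * ((Lc : ℝ) ^ (5 * (k + 1)))⁻¹) * ((Lc ^ (k + 1) : ℕ) * (Φ₀ * ((Lc : ℝ) ^ (8 * (k + 1)))⁻¹) * Real.exp κ₀)
              + (C * ((Lc : ℝ) ^ (5 * (k + 1)))⁻¹) * ((Lc ^ (k + 1) : ℕ) * (Φ₀ * ((Lc : ℝ) ^ (8 * (k + 1)))⁻¹) * Real.exp κ₀))) *
          ((((Lc ^ (k + 1) : ℕ) : ℝ)) ^ (3 + 1) * Zl (3 + 1) (κ₀ / (4 * (((3 : ℕ) : ℝ) + 1))) *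
            Real.exp (-(κ₀ / 12) * (supNorm (x' - u') + supNorm (z' - u')))) := by
  haveI : NeZero (Lc ^ (k + 1)) := ⟨pow_ne_zero _ (NeZero.ne Lc)⟩
  have hN1' : 1 ≤ Lc ^ (k + 1) := Nat.one_le_pow _ _ (by omega)
  set N : ℕ := Lc ^ (k + 1) with hNdef
  have hCB0 : 0 ≤ C * ((Lc : ℝ) ^ (5 * (k + 1)))⁻¹ := by positivity
  have hτ0 : 0 ≤ (N : ℕ) * (Φ₀ * ((Lc : ℝ) ^ (8 * (k + 1)))⁻¹) * Real.exp κ₀ := by positivity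
  have hF0 : 0 ≤ F := (faceWtSum_nonneg r Lc).trans hF
  have hEψ0 : 0 ≤ 2 * (8 * (Lc : ℝ) * C * ((Lc : ℝ) ^ (5 * (k + 1)))⁻¹ + F * ((1 + 8 * (Lc : ℝ) * (Real.exp κ₀ + 1)) * C * ((Lc : ℝ) ^ (5 * (k + 1)))⁻¹)) * (Lc : ℝ) ^ (k + 1) := by positivity
  have hMB : ∀ (μ : Fin (3 + 1)) (z : Site (3 + 1)) (a : Fin (3 + 1)) (x : Site (3 + 1)),
      |curvAdj (curv (respStep (d := 3) (Lc ^ 0) (Lc ^ (0 + k + 1)) μ z)) a x|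
        ≤ (N : ℕ) * (Φ₀ * ((Lc : ℝ) ^ (8 * (k + 1)))⁻¹) * Real.exp κ₀ * Real.exp (-(κ₀ * supNorm (quo N x - z))) := by
    intro μ z a x
    rw [curvAdj_curv_respStep_zero_eq_contourSumAdj]
    exact ht k μ z a x
  exact abs_cellIdx_le' (d := 3) (L := N) hN1' hκ (z₀ := u') (zL := x') (zR := z') hEψ0 hCB0 hCB0 hτ0 hτ0
    (abs_combGauge_le hκ.le hC hN1 hr hrr hF hLc 0 k κ' u') (fun a x => hN1 0 k α x' a x) (hMB α x') (fun b z => hN1 0 k β z' b z) (hMB β z')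

end Cells

end Summit.QuantumFields.BalabanUV.Beta.GAN24.CombContactCellBounds

end
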